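import Summits.QuantumFields.YangMills.Theorems.BalabanLadderNTCeilingPriceSmeared
import HarnessLib

/-!
# Crux `NT` (stmt-QuantumFields-19353), stub `stub_refpkgT : RefPkgT`: the one-point ceiling prices the floors, III —
# β-UNIFORM NUMBERS: `ε₂ ≤ 4C₁²K_θK_v/δ⁸`, `ε₃ ≤ 8C₁³K_fK_gK_h/(δ'/4)¹²`, `0 < C₁`, and the collar law `δ ≤ 2^{1/8} κ`

Helper file (`--supports stmt-QuantumFields-19353`) of the fleet lead prover of crux `NT` (unit `ym-spine-19353-p1`,
GEN 12); sequel of `…NTCeilingPrice` / `…NTCeilingPriceSmeared`.  Hypothesis-free, general compact `G`, any `r`, any unit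
map `a > 0` with `a → 0`.  SIZING of the registered stub: clause 1 (E1-osc with constant `C₁`, range `ℓ`) is, through
the torus-DLR collar, an exterior-free ceiling on the very correlations clauses 4–5 (and `LowerBounds`) bound from below.

* **`floor₂_le_of_e1osc`** — clause 1 + a plain clause-(i) floor `ε ≤ Q2_{β,L,aβ}(θv, v)` on all large tori at all large
  `β` (the `LowerBounds` shape), `v` with time gap `δ` (`2δ ≤ ℓ`) and lattice ℓ¹-envelopes `K_θ, K_v` ⇒ **`ε ≤ 4C₁²K_θK_v/δ⁸`**;
* **`floor₃_le_of_e1osc`** — the clause-(ii) twin: pairwise support separation `δ' ≤ 2ℓ` ⇒ **`ε ≤ 8C₁³K_fK_gK_h/(δ'/4)¹²`**;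
* **`C₁_pos_of_e1osc_floor₂`** — hence a package with an exterior-BLIND one-point law (`C₁ = 0`) carries no floor: `0 < C₁`;
* `mul_lt_of_marginFloor_le_cap`, **`timeGap_lt_of_clause4_at`** — the two-sided window on one collar-large reference torus
  (`2σ ≤ sL`, `4δ ≤ sL`): `ε + 2C₁²(s/κ)⁸S_θS_v + (≥ 0) ≤ Q2 ≤ S_θS_v(2C₁/R⁴)²`, `ε > 0` force `s·R < 2^{1/8}κ`, `δ − 3s < 2^{1/8}κ`;
* **`timeGap_le_collar`** — β-uniformly **`δ ≤ 2^{1/8} κ`**: the clause-4 witness sits within `≈ 1.09` collar widths of the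
  reflection plane (pair separation `2δ ≤ 2.19κ < 1.1ℓ`), or the `k·k'` part of its own margin exceeds the clause-1 cap.

HONEST FRAMING.  Real arithmetic and limits over the two sequels; the caps are CONDITIONAL on clause 1 (unproved at large
`β`); no floor, not AF, not NT, not the seam, not the gap; not Clay. -/

set_option autoImplicit false

noncomputable section

open scoped SchwartzMap
open MeasureTheory Filter Topology
open Literature.MathematicalPhysics.QuantumFieldTheory Literature.MathematicalPhysics.QuantumLattice
open Literature.Probability.LatticeModels
open Summit.QuantumFields.YangMills.Cruxes.OSLegsFromFemtoAndGap.DlrCollarTransfer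

namespace Summit.QuantumFields.YangMills.Cruxes.NT.CeilingPrice

/-! ## §1 Arithmetic -/

/-- The collar radius `R = ⌊δ/s⌋₊ − 2` for `0 < s`, `3s < δ`: `1 ≤ R`, `(R+2)s ≤ δ`, `(2R+3)s ≤ 2δ − s`, and `δ − 3s ≤ sR`.
[folklore] -/
theorem collarRadius_spec {δ s : ℝ} (hs : 0 < s) (h3 : 3 * s < δ) :
    1 ≤ ⌊δ / s⌋₊ - 2 ∧ (((⌊δ / s⌋₊ - 2 : ℕ) : ℝ) + 2) * s ≤ δ ∧
      ((2 * (⌊δ / s⌋₊ - 2) + 3 : ℕ) : ℝ) * s ≤ 2 * δ - s ∧ δ - 3 * s ≤ s * ((⌊δ / s⌋₊ - 2 : ℕ) : ℝ) := by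
  have hds : 3 < δ / s := by rw [lt_div_iff₀ hs]; linarith
  have hfl : 3 ≤ ⌊δ / s⌋₊ := Nat.le_floor (by exact_mod_cast hds.le)
  have hle : (⌊δ / s⌋₊ : ℝ) ≤ δ / s := Nat.floor_le (by positivity)
  have hlt : δ / s < (⌊δ / s⌋₊ : ℝ) + 1 := Nat.lt_floor_add_one _
  have hcast : (((⌊δ / s⌋₊ - 2 : ℕ) : ℝ)) = (⌊δ / s⌋₊ : ℝ) - 2 := by
    rw [Nat.cast_sub (by omega)]; norm_num
  refine ⟨by omega, ?_, ?_, ?_⟩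
  · rw [hcast]
    have : ((⌊δ / s⌋₊ : ℝ) - 2 + 2) * s = (⌊δ / s⌋₊ : ℝ) * s := by ring
    rw [this]
    calc (⌊δ / s⌋₊ : ℝ) * s ≤ δ / s * s := mul_le_mul_of_nonneg_right hle hs.le
      _ = δ := div_mul_cancel₀ δ hs.ne'
  · push_cast
    rw [hcast]
    have h1 : (⌊δ / s⌋₊ : ℝ) * s ≤ δ := by
      calc (⌊δ / s⌋₊ : ℝ) * s ≤ δ / s * s := mul_le_mul_of_nonneg_right hle hs.le
        _ = δ := div_mul_cancel₀ δ hs.ne'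
    nlinarith
  · rw [hcast]
    have h1 : δ < ((⌊δ / s⌋₊ : ℝ) + 1) * s := by
      calc δ = δ / s * s := (div_mul_cancel₀ δ hs.ne').symm
        _ < ((⌊δ / s⌋₊ : ℝ) + 1) * s := mul_lt_mul_of_pos_right hlt hs
    nlinarith

/-- `(2^{1/8})⁸ = 2`. [folklore] -/
theorem two_rpow_eighth_pow_eight : ((2 : ℝ) ^ (1 / 8 : ℝ)) ^ (8 : ℕ) = 2 := by
  rw [← Real.rpow_natCast, ← Real.rpow_mul (by norm_num : (0 : ℝ) ≤ 2)]
  norm_num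

/-- Envelope algebra, two-point: `(K_θ/s⁴)(K_v/s⁴)(2C₁/R⁴)² = 4C₁²K_θK_v/(sR)⁸`. [folklore] -/
theorem envelope_cap₂_eq {Kθ Kv C₁ s R : ℝ} (hs : s ≠ 0) (hR : R ≠ 0) :
    (Kθ / s ^ 4) * (Kv / s ^ 4) * (2 * C₁ / R ^ 4) ^ 2 = 4 * C₁ ^ 2 * Kθ * Kv / (s * R) ^ 8 := by
  field_simp
  ring

/-- Envelope algebra, three-point: `(K_f/s⁴)(K_g/s⁴)(K_h/s⁴)(2C₁/R⁴)³ = 8C₁³K_fK_gK_h/(sR)¹²`. [folklore] -/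
theorem envelope_cap₃_eq {Kf Kg Kh C₁ s R : ℝ} (hs : s ≠ 0) (hR : R ≠ 0) :
    (Kf / s ^ 4) * (Kg / s ^ 4) * (Kh / s ^ 4) * (2 * C₁ / R ^ 4) ^ 3 = 8 * C₁ ^ 3 * Kf * Kg * Kh / (s * R) ^ 12 := by
  field_simp
  ring

/-- **The two-sided window on one torus.**  If `ε > 0`, `ε + 2·(C₁(s/κ)⁴S_θ)(C₁(s/κ)⁴S_v) + T ≤ X` with `T ≥ 0` (the
registered clause-4 floor-with-margin) and `X ≤ S_θS_v(2C₁/R⁴)²` (the cap of `…NTCeilingPriceSmeared`), `S_θ, S_v ≥ 0`,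
`κ > 0`, `R ≥ 1`, then `s·R < 2^{1/8}·κ`. [folklore] -/
theorem mul_lt_of_marginFloor_le_cap {ε C₁ s κ Sθ Sv T X : ℝ} {R : ℕ} (hε : 0 < ε) (hκ : 0 < κ)
    (hSθ : 0 ≤ Sθ) (hSv : 0 ≤ Sv) (hT : 0 ≤ T) (hR : 1 ≤ R)
    (hfloor : ε + 2 * (C₁ * (s / κ) ^ 4 * Sθ) * (C₁ * (s / κ) ^ 4 * Sv) + T ≤ X)
    (hcap : X ≤ Sθ * Sv * (2 * C₁ / (R : ℝ) ^ 4) ^ 2) :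
    s * R < (2 : ℝ) ^ (1 / 8 : ℝ) * κ := by
  have hRpos : (0 : ℝ) < R := by exact_mod_cast hR
  set P := C₁ ^ 2 * (Sθ * Sv) with hP
  have hP0 : 0 ≤ P := by positivity
  have hwin : ε + 2 * P * (s / κ) ^ 8 ≤ 4 * P / (R : ℝ) ^ 8 := by
    have e1 : 2 * (C₁ * (s / κ) ^ 4 * Sθ) * (C₁ * (s / κ) ^ 4 * Sv) = 2 * P * (s / κ) ^ 8 := by rw [hP]; ring
    have e2 : Sθ * Sv * (2 * C₁ / (R : ℝ) ^ 4) ^ 2 = 4 * P / (R : ℝ) ^ 8 := by rw [hP]; field_simp; ring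
    linarith
  have hPpos : 0 < P := by
    rcases hP0.lt_or_eq with h | h
    · exact h
    · exfalso
      rw [← h] at hwin
      simp at hwin
      linarith
  have hlt8 : (s * R / κ) ^ 8 < 2 := by
    have h1 : 2 * P * (s / κ) ^ 8 < 4 * P / (R : ℝ) ^ 8 := by linarith
    have h2 : (s / κ) ^ 8 < 2 / (R : ℝ) ^ 8 := by
      have h3 : 2 * P * (s / κ) ^ 8 < 2 * P * (2 / (R : ℝ) ^ 8) := by
        calc 2 * P * (s / κ) ^ 8 < 4 * P / (R : ℝ) ^ 8 := h1
          _ = 2 * P * (2 / (R : ℝ) ^ 8) := by ring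
      exact lt_of_mul_lt_mul_left h3 (by positivity)
    have h4 : (s * R / κ) ^ 8 = (s / κ) ^ 8 * (R : ℝ) ^ 8 := by ring
    rw [h4]
    calc (s / κ) ^ 8 * (R : ℝ) ^ 8 < 2 / (R : ℝ) ^ 8 * (R : ℝ) ^ 8 :=
        mul_lt_mul_of_pos_right h2 (by positivity)
      _ = 2 := div_mul_cancel₀ 2 (by positivity)
  have hroot : s * R / κ < (2 : ℝ) ^ (1 / 8 : ℝ) := by
    by_contra hge
    have hge := le_of_not_gt hge
    have h2pos : (0 : ℝ) ≤ (2 : ℝ) ^ (1 / 8 : ℝ) := by positivity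
    have := pow_le_pow_left₀ h2pos hge 8
    rw [two_rpow_eighth_pow_eight] at this
    linarith
  rwa [div_lt_iff₀ hκ] at hroot

/-! ## §2 The floors are priced by `C₁` -/

section Package

variable (G : Type) [Group G] [TopologicalSpace G] [IsTopologicalGroup G] [CompactSpace G]
  [MeasurableSpace G] [BorelSpace G] (r : LatticeRep G)

/-- **The two-point floor is priced by the one-point ceiling.**  Let `a > 0`, `a → 0`; assume clause 1 of the registered
package (E1-osc with `C₁ ≥ 0`, range `ℓ`, eventually in `β`), and a plain clause-(i) floor in the `LowerBounds` shape:
`ε ≤ Q2_{β,L,aβ}(θv, v)` for `β ≥ β₅` and all tori with `Λ₅ ≤ aβ·L`, for a witness `v` with time gap `δ > 0`, `2δ ≤ ℓ`,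
support in the ball of radius `σ`, and lattice ℓ¹-envelopes `Σ_{x∈Λ}|θv(s x)| ≤ K_θ/s⁴`, `Σ|v(s y)| ≤ K_v/s⁴` (`0 < s ≤ 1`).
Then **`ε ≤ 4 C₁² K_θ K_v / δ⁸`** (for large `β`: `ε ≤ 4C₁²K_θK_v/(δ − 3aβ)⁸` on a torus carrying both the floor and the
collar of radius `⌊δ/aβ⌋₊ − 2`; then `β → ∞`). [folklore] -/
theorem floor₂_le_of_e1osc (a : ℝ → ℝ) (ha : ∀ β, 0 < a β) (ha0 : Tendsto a atTop (𝓝 0)) {C₁ ℓ : ℝ} (hC₁ : 0 ≤ C₁)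
    (hE1 : ∃ β₁ : ℝ, ∀ β : ℝ, β₁ ≤ β → ∀ (c : Fin 4 → ℤ) (b : ℕ), (b : ℝ) * a β ≤ ℓ →
      ∀ (η η' : LGConfig 4 G) (x : Fin 4 → ℤ), 1 ≤ depth c b x →
        |kerE G r β c b η (dens G r x) - kerE G r β c b η' (dens G r x)| ≤ C₁ / (depth c b x : ℝ) ^ 4)
    {v : 𝓢(EuclideanSpace ℝ (Fin 4), ℝ)} {δ σ Kθ Kv : ℝ} (hδ : 0 < δ) (hδℓ : 2 * δ ≤ ℓ)
    (hvδ : ∀ y : EuclideanSpace ℝ (Fin 4), v y ≠ 0 → δ ≤ y 0)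
    (hvσ : tsupport (v : EuclideanSpace ℝ (Fin 4) → ℝ) ⊆ Metric.closedBall 0 σ) (hKθ0 : 0 ≤ Kθ) (hKv0 : 0 ≤ Kv)
    (hKθ : ∀ s : ℝ, 0 < s → s ≤ 1 → ∀ Λ : Finset (Fin 4 → ℤ), ∑ x ∈ Λ, |thetaTest 4 v (s • siteToE x)| ≤ Kθ / s ^ 4)
    (hKv : ∀ s : ℝ, 0 < s → s ≤ 1 → ∀ Λ : Finset (Fin 4 → ℤ), ∑ y ∈ Λ, |v (s • siteToE y)| ≤ Kv / s ^ 4)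
    {ε β₅ Λ₅ : ℝ}
    (hfloor : ∀ β : ℝ, β₅ ≤ β → ∀ L : ℕ, Λ₅ ≤ a β * L → ε ≤ Q2 G r β L (a β) (thetaTest 4 v) v) :
    ε ≤ 4 * C₁ ^ 2 * Kθ * Kv / δ ^ 8 := by
  obtain ⟨β₁, H1⟩ := hE1
  -- eventually in `β`: the explicit cap
  have hev : ∀ᶠ β in atTop, ε ≤ 4 * C₁ ^ 2 * Kθ * Kv / (δ - 3 * a β) ^ 8 := by
    have hsmall : ∀ᶠ β in atTop, a β < min 1 (δ / 3) :=
      ha0.eventually (gt_mem_nhds (lt_min one_pos (by positivity)))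
    filter_upwards [hsmall, eventually_ge_atTop β₁, eventually_ge_atTop β₅] with β hβs hβ1 hβ5
    set s := a β with hs_def
    have hs : 0 < s := ha β
    have hs1 : s ≤ 1 := (hβs.trans_le (min_le_left _ _)).le
    have h3 : 3 * s < δ := by
      have := hβs.trans_le (min_le_right _ _); linarith
    obtain ⟨hR1, hR2, hR3, hR4⟩ := collarRadius_spec hs h3
    set R : ℕ := ⌊δ / s⌋₊ - 2 with hR_def
    -- a torus carrying the floor, the bulk condition and the collar
    set L : ℕ := ⌈Λ₅ / s⌉₊ + ⌈2 * σ / s⌉₊ + (4 * R + 8) with hL_def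
    have hLΛ : Λ₅ ≤ s * L := by
      have h1 : Λ₅ / s ≤ ⌈Λ₅ / s⌉₊ := Nat.le_ceil _
      have h2 : (⌈Λ₅ / s⌉₊ : ℝ) ≤ L := by
        rw [hL_def]; push_cast
        linarith [Nat.cast_nonneg (α := ℝ) ⌈2 * σ / s⌉₊, Nat.cast_nonneg (α := ℝ) R]
      calc Λ₅ = s * (Λ₅ / s) := by field_simp
        _ ≤ s * L := by nlinarith
    have hLσ : 2 * σ ≤ s * L := by
      have h1 : 2 * σ / s ≤ ⌈2 * σ / s⌉₊ := Nat.le_ceil _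
      have h2 : (⌈2 * σ / s⌉₊ : ℝ) ≤ L := by
        rw [hL_def]; push_cast
        linarith [Nat.cast_nonneg (α := ℝ) ⌈Λ₅ / s⌉₊, Nat.cast_nonneg (α := ℝ) R]
      calc 2 * σ = s * (2 * σ / s) := by field_simp
        _ ≤ s * L := by nlinarith
    have hRL : 4 * R + 8 ≤ L := by rw [hL_def]; omega
    have hRℓ : ((2 * R + 3 : ℕ) : ℝ) * s ≤ ℓ := hR3.trans (by linarith)
    -- floor ≤ Q2 ≤ cap
    have hfl := hfloor β hβ5 L hLΛ
    have hcap := abs_Q2_le_of_e1osc G r β hC₁ hs (H1 β hβ1) hvδ hvσ hLσ hR1 hRℓ hRL hR2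
    have hSθ := hKθ s hs hs1 (box 4 L)
    have hSv := hKv s hs hs1 (box 4 L)
    have hSθ0 : 0 ≤ ∑ x ∈ box 4 L, |thetaTest 4 v (s • siteToE x)| := Finset.sum_nonneg fun _ _ => abs_nonneg _
    have hSv0 : 0 ≤ ∑ y ∈ box 4 L, |v (s • siteToE y)| := Finset.sum_nonneg fun _ _ => abs_nonneg _
    have hc0 : 0 ≤ (2 * C₁ / (R : ℝ) ^ 4) ^ 2 := sq_nonneg _
    have hRpos : (0 : ℝ) < R := by exact_mod_cast hR1
    have hKK : 0 ≤ 4 * C₁ ^ 2 * Kθ * Kv :=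
      mul_nonneg (mul_nonneg (mul_nonneg (by norm_num) (sq_nonneg C₁)) hKθ0) hKv0
    calc ε ≤ Q2 G r β L s (thetaTest 4 v) v := hfl
      _ ≤ |Q2 G r β L s (thetaTest 4 v) v| := le_abs_self _
      _ ≤ (∑ x ∈ box 4 L, |thetaTest 4 v (s • siteToE x)|) * (∑ y ∈ box 4 L, |v (s • siteToE y)|) *
            (2 * C₁ / (R : ℝ) ^ 4) ^ 2 := hcap
      _ ≤ (Kθ / s ^ 4) * (Kv / s ^ 4) * (2 * C₁ / (R : ℝ) ^ 4) ^ 2 :=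
          mul_le_mul_of_nonneg_right (mul_le_mul hSθ hSv hSv0 (div_nonneg hKθ0 (pow_nonneg hs.le 4))) hc0
      _ = 4 * C₁ ^ 2 * Kθ * Kv / (s * R) ^ 8 := envelope_cap₂_eq hs.ne' hRpos.ne'
      _ ≤ 4 * C₁ ^ 2 * Kθ * Kv / (δ - 3 * s) ^ 8 :=
          div_le_div_of_nonneg_left hKK (pow_pos (by linarith) 8) (pow_le_pow_left₀ (by linarith) hR4 8)
  -- pass to the limit `a β → 0`
  have hlim : Tendsto (fun β => 4 * C₁ ^ 2 * Kθ * Kv / (δ - 3 * a β) ^ 8) atTop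
      (𝓝 (4 * C₁ ^ 2 * Kθ * Kv / δ ^ 8)) := by
    have h1 : Tendsto (fun β => (δ - 3 * a β) ^ 8) atTop (𝓝 ((δ - 3 * 0) ^ 8)) :=
      (tendsto_const_nhds.sub (ha0.const_mul 3)).pow 8
    rw [mul_zero, sub_zero] at h1
    exact tendsto_const_nhds.div h1 (pow_ne_zero 8 hδ.ne')
  exact ge_of_tendsto hlim hev

/-- **Hence `0 < C₁`**: under clause 1, a POSITIVE plain two-point floor is impossible with an exterior-blind one-point
law (`C₁ = 0` would cap `Q2(θv, v)` by `0`). [folklore] -/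
theorem C₁_pos_of_e1osc_floor₂ (a : ℝ → ℝ) (ha : ∀ β, 0 < a β) (ha0 : Tendsto a atTop (𝓝 0)) {C₁ ℓ : ℝ}
    (hC₁ : 0 ≤ C₁)
    (hE1 : ∃ β₁ : ℝ, ∀ β : ℝ, β₁ ≤ β → ∀ (c : Fin 4 → ℤ) (b : ℕ), (b : ℝ) * a β ≤ ℓ →
      ∀ (η η' : LGConfig 4 G) (x : Fin 4 → ℤ), 1 ≤ depth c b x →
        |kerE G r β c b η (dens G r x) - kerE G r β c b η' (dens G r x)| ≤ C₁ / (depth c b x : ℝ) ^ 4)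
    {v : 𝓢(EuclideanSpace ℝ (Fin 4), ℝ)} {δ σ Kθ Kv : ℝ} (hδ : 0 < δ) (hδℓ : 2 * δ ≤ ℓ)
    (hvδ : ∀ y : EuclideanSpace ℝ (Fin 4), v y ≠ 0 → δ ≤ y 0)
    (hvσ : tsupport (v : EuclideanSpace ℝ (Fin 4) → ℝ) ⊆ Metric.closedBall 0 σ) (hKθ0 : 0 ≤ Kθ) (hKv0 : 0 ≤ Kv)
    (hKθ : ∀ s : ℝ, 0 < s → s ≤ 1 → ∀ Λ : Finset (Fin 4 → ℤ), ∑ x ∈ Λ, |thetaTest 4 v (s • siteToE x)| ≤ Kθ / s ^ 4)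
    (hKv : ∀ s : ℝ, 0 < s → s ≤ 1 → ∀ Λ : Finset (Fin 4 → ℤ), ∑ y ∈ Λ, |v (s • siteToE y)| ≤ Kv / s ^ 4)
    {ε β₅ Λ₅ : ℝ} (hε : 0 < ε)
    (hfloor : ∀ β : ℝ, β₅ ≤ β → ∀ L : ℕ, Λ₅ ≤ a β * L → ε ≤ Q2 G r β L (a β) (thetaTest 4 v) v) :
    0 < C₁ := by
  rcases hC₁.lt_or_eq with h | h
  · exact h
  · exfalso
    have key := floor₂_le_of_e1osc G r a ha ha0 hC₁ hE1 hδ hδℓ hvδ hvσ hKθ0 hKv0 hKθ hKv hfloor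
    rw [← h] at key
    simp at key
    linarith

/-- **The three-point floor is priced by the one-point ceiling.**  Clause 1 (`C₁ ≥ 0`, range `ℓ`) + a plain
clause-(ii) floor `ε ≤ |Q3_{β,L,aβ}(f, g, h)|` on all large tori at all large `β`, for witnesses in the ball of radius `σ`
with pairwise support separation `δ' > 0`, `δ' ≤ 2ℓ`, and ℓ¹-envelopes `K_f, K_g, K_h` ⇒
**`ε ≤ 8 C₁³ K_f K_g K_h / (δ'/4)¹²`**. [folklore] -/
theorem floor₃_le_of_e1osc (a : ℝ → ℝ) (ha : ∀ β, 0 < a β) (ha0 : Tendsto a atTop (𝓝 0)) {C₁ ℓ : ℝ} (hC₁ : 0 ≤ C₁)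
    (hE1 : ∃ β₁ : ℝ, ∀ β : ℝ, β₁ ≤ β → ∀ (c : Fin 4 → ℤ) (b : ℕ), (b : ℝ) * a β ≤ ℓ →
      ∀ (η η' : LGConfig 4 G) (x : Fin 4 → ℤ), 1 ≤ depth c b x →
        |kerE G r β c b η (dens G r x) - kerE G r β c b η' (dens G r x)| ≤ C₁ / (depth c b x : ℝ) ^ 4)
    {f g h : 𝓢(EuclideanSpace ℝ (Fin 4), ℝ)} {δ' σ Kf Kg Kh : ℝ} (hδ' : 0 < δ') (hδ'ℓ : δ' ≤ 2 * ℓ)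
    (hfg : ∀ p q : EuclideanSpace ℝ (Fin 4), f p ≠ 0 → g q ≠ 0 → δ' ≤ ‖p - q‖)
    (hgh : ∀ p q : EuclideanSpace ℝ (Fin 4), g p ≠ 0 → h q ≠ 0 → δ' ≤ ‖p - q‖)
    (hfh : ∀ p q : EuclideanSpace ℝ (Fin 4), f p ≠ 0 → h q ≠ 0 → δ' ≤ ‖p - q‖)
    (hfσ : tsupport (f : EuclideanSpace ℝ (Fin 4) → ℝ) ⊆ Metric.closedBall 0 σ)
    (hgσ : tsupport (g : EuclideanSpace ℝ (Fin 4) → ℝ) ⊆ Metric.closedBall 0 σ)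
    (hhσ : tsupport (h : EuclideanSpace ℝ (Fin 4) → ℝ) ⊆ Metric.closedBall 0 σ) (hKf0 : 0 ≤ Kf) (hKg0 : 0 ≤ Kg)
    (hKh0 : 0 ≤ Kh)
    (hKf : ∀ s : ℝ, 0 < s → s ≤ 1 → ∀ Λ : Finset (Fin 4 → ℤ), ∑ x ∈ Λ, |f (s • siteToE x)| ≤ Kf / s ^ 4)
    (hKg : ∀ s : ℝ, 0 < s → s ≤ 1 → ∀ Λ : Finset (Fin 4 → ℤ), ∑ y ∈ Λ, |g (s • siteToE y)| ≤ Kg / s ^ 4)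
    (hKh : ∀ s : ℝ, 0 < s → s ≤ 1 → ∀ Λ : Finset (Fin 4 → ℤ), ∑ z ∈ Λ, |h (s • siteToE z)| ≤ Kh / s ^ 4)
    {ε β₅ Λ₅ : ℝ}
    (hfloor : ∀ β : ℝ, β₅ ≤ β → ∀ L : ℕ, Λ₅ ≤ a β * L → ε ≤ |Q3 G r β L (a β) f g h|) :
    ε ≤ 8 * C₁ ^ 3 * Kf * Kg * Kh / (δ' / 4) ^ 12 := by
  obtain ⟨β₁, H1⟩ := hE1
  have hδ4 : 0 < δ' / 4 := by positivity
  have hev : ∀ᶠ β in atTop, ε ≤ 8 * C₁ ^ 3 * Kf * Kg * Kh / (δ' / 4 - 3 * a β) ^ 12 := by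
    have hsmall : ∀ᶠ β in atTop, a β < min 1 (δ' / 4 / 3) :=
      ha0.eventually (gt_mem_nhds (lt_min one_pos (by positivity)))
    filter_upwards [hsmall, eventually_ge_atTop β₁, eventually_ge_atTop β₅] with β hβs hβ1 hβ5
    set s := a β with hs_def
    have hs : 0 < s := ha β
    have hs1 : s ≤ 1 := (hβs.trans_le (min_le_left _ _)).le
    have h3 : 3 * s < δ' / 4 := by
      have := hβs.trans_le (min_le_right _ _); linarith
    obtain ⟨hR1, hR2, hR3, hR4⟩ := collarRadius_spec hs h3
    set R : ℕ := ⌊δ' / 4 / s⌋₊ - 2 with hR_def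
    set L : ℕ := ⌈Λ₅ / s⌉₊ + ⌈2 * σ / s⌉₊ + (4 * R + 8) with hL_def
    have hLΛ : Λ₅ ≤ s * L := by
      have h1 : Λ₅ / s ≤ ⌈Λ₅ / s⌉₊ := Nat.le_ceil _
      have h2 : (⌈Λ₅ / s⌉₊ : ℝ) ≤ L := by
        rw [hL_def]; push_cast
        linarith [Nat.cast_nonneg (α := ℝ) ⌈2 * σ / s⌉₊, Nat.cast_nonneg (α := ℝ) R]
      calc Λ₅ = s * (Λ₅ / s) := by field_simp
        _ ≤ s * L := by nlinarith
    have hLσ : 2 * σ ≤ s * L := by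
      have h1 : 2 * σ / s ≤ ⌈2 * σ / s⌉₊ := Nat.le_ceil _
      have h2 : (⌈2 * σ / s⌉₊ : ℝ) ≤ L := by
        rw [hL_def]; push_cast
        linarith [Nat.cast_nonneg (α := ℝ) ⌈Λ₅ / s⌉₊, Nat.cast_nonneg (α := ℝ) R]
      calc 2 * σ = s * (2 * σ / s) := by field_simp
        _ ≤ s * L := by nlinarith
    have hRL : 4 * R + 8 ≤ L := by rw [hL_def]; omega
    have hRℓ : ((2 * R + 3 : ℕ) : ℝ) * s ≤ ℓ := hR3.trans (by linarith)
    have hRδ : 4 * (((R : ℝ) + 2) * s) ≤ δ' := by linarith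
    have hfl := hfloor β hβ5 L hLΛ
    have hcap := abs_Q3_le_of_e1osc G r β hC₁ hs (H1 β hβ1) hfg hgh hfh hfσ hgσ hhσ hLσ hR1 hRℓ hRL hRδ
    have hSf := hKf s hs hs1 (box 4 L)
    have hSg := hKg s hs hs1 (box 4 L)
    have hSh := hKh s hs hs1 (box 4 L)
    have hSf0 : 0 ≤ ∑ x ∈ box 4 L, |f (s • siteToE x)| := Finset.sum_nonneg fun _ _ => abs_nonneg _
    have hSg0 : 0 ≤ ∑ y ∈ box 4 L, |g (s • siteToE y)| := Finset.sum_nonneg fun _ _ => abs_nonneg _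
    have hSh0 : 0 ≤ ∑ z ∈ box 4 L, |h (s • siteToE z)| := Finset.sum_nonneg fun _ _ => abs_nonneg _
    have hRpos : (0 : ℝ) < R := by exact_mod_cast hR1
    have hs4 : 0 ≤ s ^ 4 := pow_nonneg hs.le 4
    have hc0 : 0 ≤ (2 * C₁ / (R : ℝ) ^ 4) ^ 3 :=
      pow_nonneg (div_nonneg (mul_nonneg zero_le_two hC₁) (pow_nonneg hRpos.le 4)) 3
    have hKK : 0 ≤ 8 * C₁ ^ 3 * Kf * Kg * Kh :=
      mul_nonneg (mul_nonneg (mul_nonneg (mul_nonneg (by norm_num) (pow_nonneg hC₁ 3)) hKf0) hKg0) hKh0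
    have hK1 : 0 ≤ Kf / s ^ 4 := div_nonneg hKf0 hs4
    have hK2 : 0 ≤ Kf / s ^ 4 * (Kg / s ^ 4) := mul_nonneg hK1 (div_nonneg hKg0 hs4)
    calc ε ≤ |Q3 G r β L s f g h| := hfl
      _ ≤ (∑ x ∈ box 4 L, |f (s • siteToE x)|) * (∑ y ∈ box 4 L, |g (s • siteToE y)|) *
            (∑ z ∈ box 4 L, |h (s • siteToE z)|) * (2 * C₁ / (R : ℝ) ^ 4) ^ 3 := hcap
      _ ≤ (Kf / s ^ 4) * (Kg / s ^ 4) * (Kh / s ^ 4) * (2 * C₁ / (R : ℝ) ^ 4) ^ 3 :=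
          mul_le_mul_of_nonneg_right (mul_le_mul (mul_le_mul hSf hSg hSg0 hK1) hSh hSh0 hK2) hc0
      _ = 8 * C₁ ^ 3 * Kf * Kg * Kh / (s * R) ^ 12 := envelope_cap₃_eq hs.ne' hRpos.ne'
      _ ≤ 8 * C₁ ^ 3 * Kf * Kg * Kh / (δ' / 4 - 3 * s) ^ 12 :=
          div_le_div_of_nonneg_left hKK (pow_pos (by linarith) 12) (pow_le_pow_left₀ (by linarith) hR4 12)
  have hlim : Tendsto (fun β => 8 * C₁ ^ 3 * Kf * Kg * Kh / (δ' / 4 - 3 * a β) ^ 12) atTop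
      (𝓝 (8 * C₁ ^ 3 * Kf * Kg * Kh / (δ' / 4) ^ 12)) := by
    have h1 : Tendsto (fun β => (δ' / 4 - 3 * a β) ^ 12) atTop (𝓝 ((δ' / 4 - 3 * 0) ^ 12)) :=
      (tendsto_const_nhds.sub (ha0.const_mul 3)).pow 12
    rw [mul_zero, sub_zero] at h1
    exact tendsto_const_nhds.div h1 (pow_ne_zero 12 hδ4.ne')
  exact ge_of_tendsto hlim hev

/-! ## §3 The collar law `δ ≤ 2^{1/8} κ` -/

/-- **The collar law at one coupling.**  At coupling `β`, spacing `0 < s ≤ 1` with `3s < δ`: clause 1 (E1-osc, `C₁ ≥ 0`,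
range `ℓ ≥ 2δ`) and the registered clause-4 floor-with-margin for a witness `v` (time gap `δ`, support in the ball of radius
`σ`, `ε > 0`, `κ > 0`, `C₂ ≥ 0`) on a collar-large reference torus (`2σ ≤ sL`, `4δ ≤ sL`) force
**`δ − 3s < 2^{1/8} κ`**. [folklore] -/
theorem timeGap_lt_of_clause4_at (β : ℝ) {C₁ C₂ ℓ s κ : ℝ} (hC₁ : 0 ≤ C₁) (hC₂ : 0 ≤ C₂) (hκ : 0 < κ) (hs : 0 < s)
    (hE1 : ∀ (c : Fin 4 → ℤ) (b : ℕ), (b : ℝ) * s ≤ ℓ → ∀ (η η' : LGConfig 4 G) (x : Fin 4 → ℤ),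
      1 ≤ depth c b x → |kerE G r β c b η (dens G r x) - kerE G r β c b η' (dens G r x)| ≤ C₁ / (depth c b x : ℝ) ^ 4)
    {v : 𝓢(EuclideanSpace ℝ (Fin 4), ℝ)} {δ σ ε : ℝ} (hε : 0 < ε) (h3 : 3 * s < δ) (hδℓ : 2 * δ ≤ ℓ)
    (hvδ : ∀ y : EuclideanSpace ℝ (Fin 4), v y ≠ 0 → δ ≤ y 0)
    (hvσ : tsupport (v : EuclideanSpace ℝ (Fin 4) → ℝ) ⊆ Metric.closedBall 0 σ) {L : ℕ} (hσL : 2 * σ ≤ s * L)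
    (hδL : 4 * δ ≤ s * L)
    (hfloor : ε + 2 * (C₁ * (s / κ) ^ 4 * ∑ x ∈ box 4 L, |thetaTest 4 v (s • siteToE x)|) *
          (C₁ * (s / κ) ^ 4 * ∑ y ∈ box 4 L, |v (s • siteToE y)|) +
        C₂ * (s / κ) ^ 4 * ∑ x ∈ box 4 L, ∑ y ∈ box 4 L,
          |thetaTest 4 v (s • siteToE x)| * |v (s • siteToE y)| / (1 + ‖siteToE (y - x)‖) ^ 4 ≤
      Q2 G r β L s (thetaTest 4 v) v) :
    δ - 3 * s < (2 : ℝ) ^ (1 / 8 : ℝ) * κ := by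
  obtain ⟨hR1, hR2, hR3, hR4⟩ := collarRadius_spec hs h3
  set R : ℕ := ⌊δ / s⌋₊ - 2 with hR_def
  have hRℓ : ((2 * R + 3 : ℕ) : ℝ) * s ≤ ℓ := hR3.trans (by linarith)
  have hRL : 4 * R + 8 ≤ L := by
    have h1 : (4 * (R : ℝ) + 8) * s ≤ 4 * δ := by nlinarith
    have h2 : (4 * (R : ℝ) + 8) * s ≤ s * L := h1.trans hδL
    have h3' : (4 * (R : ℝ) + 8) ≤ L := by
      rw [mul_comm] at h2; exact le_of_mul_le_mul_left h2 hs
    exact_mod_cast h3'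
  have hcap := abs_Q2_le_of_e1osc G r β hC₁ hs hE1 hvδ hvσ hσL hR1 hRℓ hRL hR2
  have hSθ0 : 0 ≤ ∑ x ∈ box 4 L, |thetaTest 4 v (s • siteToE x)| := Finset.sum_nonneg fun _ _ => abs_nonneg _
  have hSv0 : 0 ≤ ∑ y ∈ box 4 L, |v (s • siteToE y)| := Finset.sum_nonneg fun _ _ => abs_nonneg _
  have hT : 0 ≤ C₂ * (s / κ) ^ 4 * ∑ x ∈ box 4 L, ∑ y ∈ box 4 L,
      |thetaTest 4 v (s • siteToE x)| * |v (s • siteToE y)| / (1 + ‖siteToE (y - x)‖) ^ 4 := by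
    refine mul_nonneg (by positivity) (Finset.sum_nonneg fun x _ => Finset.sum_nonneg fun y _ => ?_)
    positivity
  have key := mul_lt_of_marginFloor_le_cap hε hκ hSθ0 hSv0 hT hR1 hfloor ((le_abs_self _).trans hcap)
  exact hR4.trans_lt key

/-- **The collar law, β-uniformly: `δ ≤ 2^{1/8} κ`.**  Let `a > 0`, `a → 0`; assume clause 1 of the registered package
(`C₁ ≥ 0`, range `ℓ`) and its clause 4 for a witness `v` with time gap `δ > 0` (`2δ ≤ ℓ`), support in the ball of radius
`σ`, `ε > 0`, on reference tori `L₀ β` that are collar-large (`2σ ≤ aβ·L₀β` and `4δ ≤ aβ·L₀β` — in the registered letters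
this holds whenever `max (2σ) (4δ) ≤ σ + κ + 1`).  Then the witness sits within `2^{1/8}` collar widths of the reflection
plane: **`δ ≤ 2^{1/8}·κ`**. [folklore] -/
theorem timeGap_le_collar (a : ℝ → ℝ) (ha : ∀ β, 0 < a β) (ha0 : Tendsto a atTop (𝓝 0)) {C₁ C₂ ℓ κ : ℝ}
    (hC₁ : 0 ≤ C₁) (hC₂ : 0 ≤ C₂) (hκ : 0 < κ)
    (hE1 : ∃ β₁ : ℝ, ∀ β : ℝ, β₁ ≤ β → ∀ (c : Fin 4 → ℤ) (b : ℕ), (b : ℝ) * a β ≤ ℓ →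
      ∀ (η η' : LGConfig 4 G) (x : Fin 4 → ℤ), 1 ≤ depth c b x →
        |kerE G r β c b η (dens G r x) - kerE G r β c b η' (dens G r x)| ≤ C₁ / (depth c b x : ℝ) ^ 4)
    {v : 𝓢(EuclideanSpace ℝ (Fin 4), ℝ)} {δ σ ε : ℝ} (hε : 0 < ε) (hδ : 0 < δ) (hδℓ : 2 * δ ≤ ℓ)
    (hvδ : ∀ y : EuclideanSpace ℝ (Fin 4), v y ≠ 0 → δ ≤ y 0)
    (hvσ : tsupport (v : EuclideanSpace ℝ (Fin 4) → ℝ) ⊆ Metric.closedBall 0 σ) {β₅ : ℝ} {L₀ : ℝ → ℕ}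
    (hL₀ : ∀ β : ℝ, β₅ ≤ β → 2 * σ ≤ a β * L₀ β ∧ 4 * δ ≤ a β * L₀ β)
    (hfloor : ∀ β : ℝ, β₅ ≤ β →
      ε + 2 * (C₁ * (a β / κ) ^ 4 * ∑ x ∈ box 4 (L₀ β), |thetaTest 4 v (a β • siteToE x)|) *
            (C₁ * (a β / κ) ^ 4 * ∑ y ∈ box 4 (L₀ β), |v (a β • siteToE y)|) +
          C₂ * (a β / κ) ^ 4 * ∑ x ∈ box 4 (L₀ β), ∑ y ∈ box 4 (L₀ β),
            |thetaTest 4 v (a β • siteToE x)| * |v (a β • siteToE y)| / (1 + ‖siteToE (y - x)‖) ^ 4 ≤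
        Q2 G r β (L₀ β) (a β) (thetaTest 4 v) v) :
    δ ≤ (2 : ℝ) ^ (1 / 8 : ℝ) * κ := by
  obtain ⟨β₁, H1⟩ := hE1
  have hev : ∀ᶠ β in atTop, δ - 3 * a β < (2 : ℝ) ^ (1 / 8 : ℝ) * κ := by
    have hsmall : ∀ᶠ β in atTop, a β < min 1 (δ / 3) :=
      ha0.eventually (gt_mem_nhds (lt_min one_pos (by positivity)))
    filter_upwards [hsmall, eventually_ge_atTop β₁, eventually_ge_atTop β₅] with β hβs hβ1 hβ5
    have h3 : 3 * a β < δ := by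
      have := hβs.trans_le (min_le_right _ _); linarith
    obtain ⟨hσL, hδL⟩ := hL₀ β hβ5
    exact timeGap_lt_of_clause4_at G r β hC₁ hC₂ hκ (ha β) (H1 β hβ1) hε h3 hδℓ hvδ hvσ hσL hδL (hfloor β hβ5)
  have hlim : Tendsto (fun β => δ - 3 * a β) atTop (𝓝 (δ - 3 * 0)) := tendsto_const_nhds.sub (ha0.const_mul 3)
  rw [mul_zero, sub_zero] at hlim
  exact le_of_tendsto hlim (hev.mono fun β hβ => hβ.le)

end Package

end Summit.QuantumFields.YangMills.Cruxes.NT.CeilingPrice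

end
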